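import Literature.NumberTheory.EllipticCurves.TwoAdicImageGoodOrdinaryAtTwoProofs
import Literature.NumberTheory.EllipticCurves.BSDSelmerSkinnerThmBProofs
import HarnessLib

/-!
# The `2`-adic image of a curve MULTIPLICATIVE at `2`: Dokchitser–Dokchitser's exceptional families
# sorted by the `2`-adic valuation of the minimal discriminant (proofs only)

Topic `NumberTheory/EllipticCurves`; theorem-only `Proofs`-style file (no definition, no named fact,
no instance, no `sorry`; D-0014/D-0026), the multiplicative-at-`2` companion of
`TwoAdicImageGoodOrdinaryAtTwoProofs`.

For `E/ℚ` in its globally minimal equation `W` with MULTIPLICATIVE reduction at `2`, `a₁` is odd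
(`odd_a₁_of_hasMultiplicativeReductionAtPrime_two`, Silverman VII.5.1(b)), so `c₄` is odd, while the
minimal discriminant has `n := v₂(Δ_min) ≥ 1`; hence `v₂(j) = -n` (`j = c₄³/Δ`; `n` is also the order
of the component group at a split multiplicative `2`).  Reading Dokchitser–Dokchitser's families
against `n`:

* (γ₃) `j = -4t³(t + 8)` forces `n ≡ 2 (mod 4)` — the `2`-adic valuation of `-4t³(t + 8)` is
  `2 + 4v(t)` or `≥ 14` (`padicValRat_dokchitser_eq_or_ge`), and it must equal `-n < 0`;
* (γ₄) `2Δ ∈ ℚ^{×2}` or `-2Δ ∈ ℚ^{×2}` forces `n` odd; (γ₁)/(γ₂) `±Δ ∈ ℚ^{×2}` force `n` even.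

Consequences (`Rank1Residual.Mult W 2`): if `4 ∣ n` the off-habitat complement is again the THREE strata
(β) rational `2`-torsion, (γ₁) `C₃` image, (γ₂) `ℚ(√Δ) = ℚ(i)`
(`forall_hasSurjectiveModNGaloisRep_two_pow_iff_of_mult_two_of_four_dvd`); if `n` is odd it is
(β) ∪ (γ₄) only (`…_of_mult_two_of_odd`).

Written for the BSD cell `bsd-2adic` (items 19219 `MultiplicativeRankZeroTwoConverse` / KRR2's residual
24303, multiplicative piece).  Nothing about BSD is claimed.

## References

* [DokchitserDokchitserMathZ2012] T. Dokchitser, V. Dokchitser, *Surjectivity of mod `2ⁿ`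
  representations of elliptic curves*, Math. Z. 272 (2012) 961–964, Theorem (1)–(3) and Lemma.
* [SilvermanAEC2009] J. H. Silverman, *The Arithmetic of Elliptic Curves*, 2nd ed., GTM 106 (2009),
  VII.5 Prop. 5.1(b) (multiplicative ⟺ `v(Δ) > 0`, `v(c₄) = 0` on a minimal equation), C.15.
-/

set_option autoImplicit false

open WeierstrassCurve

namespace Literature.NumberTheory.EllipticCurves

open Rank1Residual

/-! ### §1. The `2`-adic valuation of `-4t³(t + 8)` -/

/-- **`v₂(-4t³(t + 8))` is `2 + 4v₂(t)` or at least `14`** (`t ∉ {0, -8}`): if `v(t) < 3` then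
`v(t + 8) = v(t)`; if `v(t) > 3` then `v(t + 8) = 3` and the value is `5 + 3v(t) ≥ 17`; if `v(t) = 3`
then `v(t + 8) ≥ 3` and the value is `≥ 14`. [cite: DokchitserDokchitserMathZ2012, Lemma (3) (the family j = -4t³(t+8))] -/
theorem padicValRat_dokchitser_eq_or_ge (t : ℚ) (ht0 : t ≠ 0) (ht8 : t + 8 ≠ 0) :
    padicValRat 2 (-4 * t ^ 3 * (t + 8)) = 2 + 4 * padicValRat 2 t ∨
      14 ≤ padicValRat 2 (-4 * t ^ 3 * (t + 8)) := by
  haveI : Fact (Nat.Prime 2) := ⟨Nat.prime_two⟩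
  have h4 : padicValRat 2 (-4 : ℚ) = 2 := by
    rw [show (-4 : ℚ) = -(((2 : ℕ) : ℚ) ^ 2) by norm_num, padicValRat.neg, padicValRat.pow,
      padicValRat.self one_lt_two]
    norm_num
  have h8v : padicValRat 2 (8 : ℚ) = 3 := by
    rw [show (8 : ℚ) = ((2 : ℕ) : ℚ) ^ 3 by norm_num, padicValRat.pow, padicValRat.self one_lt_two]
    norm_num
  have hrhs : padicValRat 2 (-4 * t ^ 3 * (t + 8)) =
      2 + 3 * padicValRat 2 t + padicValRat 2 (t + 8) := by
    rw [padicValRat.mul (mul_ne_zero (by norm_num) (pow_ne_zero 3 ht0)) ht8,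
      padicValRat.mul (by norm_num) (pow_ne_zero 3 ht0), padicValRat.pow, h4]
    push_cast
    ring
  rw [hrhs]
  rcases lt_trichotomy (padicValRat 2 t) 3 with hlt | heq | hgt
  · have hsum : padicValRat 2 (t + 8) = padicValRat 2 t :=
      padicValRat.add_eq_of_lt ht8 ht0 (by norm_num) (by rw [h8v]; exact hlt)
    left; rw [hsum]; ring
  · have hmin := padicValRat.min_le_padicValRat_add (p := 2) ht8
    rw [h8v, heq, min_self] at hmin
    right; omega
  · have hsum : padicValRat 2 (t + 8) = 3 := by
      rw [add_comm, padicValRat.add_eq_of_lt (by rwa [add_comm]) (by norm_num) ht0 (by rw [h8v]; exact hgt),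
        h8v]
    right; rw [hsum]; omega

/-- **An element of NEGATIVE `2`-adic valuation on the curve `j = -4t³(t + 8)` has valuation
`≡ 2 (mod 4)`** (indeed `= 2 + 4v(t)` with `v(t) < 0`). [cite: DokchitserDokchitserMathZ2012, Lemma (3)] -/
theorem padicValRat_emod_four_of_eq_dokchitser_of_neg {j : ℚ} {t : ℚ} (hj : j = -4 * t ^ 3 * (t + 8))
    (hneg : padicValRat 2 j < 0) : padicValRat 2 j % 4 = 2 := by
  haveI : Fact (Nat.Prime 2) := ⟨Nat.prime_two⟩
  have hj0 : j ≠ 0 := by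
    intro h; rw [h] at hneg; simp at hneg
  have ht0 : t ≠ 0 := by rintro rfl; exact hj0 (by rw [hj]; ring)
  have ht8 : t + 8 ≠ 0 := by intro h8; exact hj0 (by rw [hj, h8]; ring)
  rcases padicValRat_dokchitser_eq_or_ge t ht0 ht8 with h | h
  · rw [hj, h]; omega
  · rw [← hj] at h; omega

/-! ### §2. Multiplicative reduction at `2`: `c₄` odd, `v₂(Δ_min) ≥ 1`, `v₂(j) = -v₂(Δ_min)` -/

section MultAtTwo

variable (W : WeierstrassCurve ℚ) [W.IsElliptic] [W.IsGloballyMinimal]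

/-- **At a multiplicative `2`, `v₂(j) = -v₂(Δ_min) < 0`** (`c₄` odd on the minimal equation, `2 ∣ Δ_min`).
[cite: SilvermanAEC2009, VII.5 Prop. 5.1(b)] -/
theorem padicValRat_j_of_mult_two (hm : Mult W 2) :
    padicValRat 2 W.j = -(padicValInt 2 (minimalDiscriminantInt W) : ℤ) ∧
      1 ≤ padicValInt 2 (minimalDiscriminantInt W) := by
  haveI : Fact (Nat.Prime 2) := ⟨Nat.prime_two⟩
  have hc₄ : Odd (integralModelInt W).c₄ :=
    (integralModelInt W).odd_c₄_int_of_odd_a₁ (odd_a₁_of_hasMultiplicativeReductionAtPrime_two W hm)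
  have hn : 1 ≤ padicValInt 2 (minimalDiscriminantInt W) :=
    one_le_padicValInt_minimalDiscriminantInt W hm
  have hΔ0 : ((integralModelInt W).Δ : ℚ) ≠ 0 := by
    have := minimalDiscriminantInt_ne_zero W
    rw [minimalDiscriminantInt] at this
    exact_mod_cast this
  have hc0 : ((integralModelInt W).c₄ : ℚ) ≠ 0 := by
    exact_mod_cast fun h ↦ (Int.not_even_iff_odd.mpr hc₄) (by simp [h])
  refine ⟨?_, hn⟩
  rw [j_eq_intCast_c₄_pow_div_intCast_Δ W, padicValRat.div (pow_ne_zero 3 hc0) hΔ0, padicValRat.pow,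
    padicValRat.of_int, padicValRat.of_int, padicValInt.eq_zero_of_not_dvd
      (by simpa [even_iff_two_dvd] using Int.not_even_iff_odd.mpr hc₄), minimalDiscriminantInt]
  simp

/-- **(γ₃) at a multiplicative `2` forces `v₂(Δ_min) ≡ 2 (mod 4)`**: if `j(W) = -4t³(t + 8)` then
`v₂(Δ_min) % 4 = 2` (the component-group exponent at a split `2` is `≡ 2 (mod 4)`).
[cite: DokchitserDokchitserMathZ2012, Theorem (2) and Lemma (3)] [cite: SilvermanAEC2009, VII.5 Prop. 5.1(b)] -/
theorem padicValInt_minimalDiscriminantInt_emod_four_of_mult_two_of_j_eq (hm : Mult W 2) {t : ℚ}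
    (hj : W.j = -4 * t ^ 3 * (t + 8)) :
    (padicValInt 2 (minimalDiscriminantInt W) : ℤ) % 4 = 2 := by
  obtain ⟨hv, hn⟩ := padicValRat_j_of_mult_two W hm
  have hneg : padicValRat 2 W.j < 0 := by rw [hv]; omega
  have h := padicValRat_emod_four_of_eq_dokchitser_of_neg hj hneg
  rw [hv] at h
  omega

/-- **At a multiplicative `2` with `v₂(Δ_min) ≢ 2 (mod 4)` the Dokchitser–Dokchitser curve is not met.**
[cite: DokchitserDokchitserMathZ2012, Theorem (2) and Lemma (3)] -/
theorem j_ne_of_mult_two_of_emod_four_ne (hm : Mult W 2)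
    (hn : (padicValInt 2 (minimalDiscriminantInt W) : ℤ) % 4 ≠ 2) (t : ℚ) :
    W.j ≠ -4 * t ^ 3 * (t + 8) :=
  fun hj ↦ hn (padicValInt_minimalDiscriminantInt_emod_four_of_mult_two_of_j_eq W hm hj)

omit [W.IsElliptic] in
/-- **`±Δ ∈ ℚ^{×2}` forces `v₂(Δ_min)` even; `±2Δ ∈ ℚ^{×2}` forces it odd** (valuation of a square is
even). [cite: DokchitserDokchitserMathZ2012, Theorem (1), (2), (3) (the conditions on Δ modulo squares)] -/
theorem even_or_odd_padicValInt_minimalDiscriminantInt_of_isSquare (hΔ0 : minimalDiscriminantInt W ≠ 0) :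
    (IsSquare W.Δ ∨ IsSquare (-W.Δ) → Even (padicValInt 2 (minimalDiscriminantInt W))) ∧
      (IsSquare (2 * W.Δ) ∨ IsSquare (-2 * W.Δ) → Odd (padicValInt 2 (minimalDiscriminantInt W))) := by
  haveI : Fact (Nat.Prime 2) := ⟨Nat.prime_two⟩
  have hΔQ : W.Δ = (minimalDiscriminantInt W : ℚ) := (cast_minimalDiscriminantInt W).symm
  have hΔ0' : (minimalDiscriminantInt W : ℚ) ≠ 0 := by exact_mod_cast hΔ0
  have hvΔ : padicValRat 2 W.Δ = padicValInt 2 (minimalDiscriminantInt W) := by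
    rw [hΔQ, padicValRat.of_int]
  -- the valuation of a non-zero square is even
  have hsq : ∀ {a : ℚ}, a ≠ 0 → IsSquare a → Even (padicValRat 2 a) := by
    intro a ha ⟨s, hs⟩
    have hs0 : s ≠ 0 := fun h ↦ ha (by rw [hs, h, mul_zero])
    rw [hs, padicValRat.mul hs0 hs0]
    exact ⟨_, rfl⟩
  have h2 : padicValRat 2 (2 : ℚ) = 1 := by
    rw [show (2 : ℚ) = ((2 : ℕ) : ℚ) by norm_num, padicValRat.self one_lt_two]
  constructor
  · rintro (h | h)
    · have he := hsq (by rw [hΔQ]; exact hΔ0') h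
      rw [hvΔ] at he
      exact (Int.even_coe_nat _).mp he
    · have he := hsq (neg_ne_zero.mpr (by rw [hΔQ]; exact hΔ0')) h
      rw [padicValRat.neg, hvΔ] at he
      exact (Int.even_coe_nat _).mp he
  · rintro (h | h)
    · have he := hsq (mul_ne_zero two_ne_zero (by rw [hΔQ]; exact hΔ0')) h
      rw [padicValRat.mul two_ne_zero (by rw [hΔQ]; exact hΔ0'), h2, hvΔ] at he
      rcases Nat.even_or_odd (padicValInt 2 (minimalDiscriminantInt W)) with hev | hod
      · exfalso
        obtain ⟨k, hk⟩ := hev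
        obtain ⟨r, hr⟩ := he
        omega
      · exact hod
    · have he := hsq (mul_ne_zero (by norm_num) (by rw [hΔQ]; exact hΔ0')) h
      rw [show (-2 : ℚ) * W.Δ = -(2 * W.Δ) by ring, padicValRat.neg,
        padicValRat.mul two_ne_zero (by rw [hΔQ]; exact hΔ0'), h2, hvΔ] at he
      rcases Nat.even_or_odd (padicValInt 2 (minimalDiscriminantInt W)) with hev | hod
      · exfalso
        obtain ⟨k, hk⟩ := hev
        obtain ⟨r, hr⟩ := he
        omega
      · exact hod

/-- **At a multiplicative `2` with `4 ∣ v₂(Δ_min)`: only THREE strata off the habitat** — `ρ_{W,2^∞}` is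
onto iff `W(ℚ)[2] = 0`, `Δ ∉ ℚ^{×2}` and `-Δ ∉ ℚ^{×2}` (the families `j = -4t³(t + 8)` and
`±2Δ ∈ ℚ^{×2}` need `v₂(Δ_min) ≡ 2 (mod 4)` resp. odd).
[cite: DokchitserDokchitserMathZ2012, Theorem (1)–(3)] [cite: SilvermanAEC2009, VII.5 Prop. 5.1(b)] -/
theorem forall_hasSurjectiveModNGaloisRep_two_pow_iff_of_mult_two_of_four_dvd (hm : Mult W 2)
    (h4 : 4 ∣ padicValInt 2 (minimalDiscriminantInt W)) :
    (∀ m : ℕ, W.HasSurjectiveModNGaloisRep ((2 ^ m : ℕ) : ℤ)) ↔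
      (∀ P : W.toAffine.Point, 2 • P = 0 → P = 0) ∧ ¬ IsSquare W.Δ ∧ ¬ IsSquare (-W.Δ) := by
  have hΔ0 := minimalDiscriminantInt_ne_zero W
  obtain ⟨-, hodd⟩ := even_or_odd_padicValInt_minimalDiscriminantInt_of_isSquare W hΔ0
  have hn4 : (padicValInt 2 (minimalDiscriminantInt W) : ℤ) % 4 ≠ 2 := by
    obtain ⟨k, hk⟩ := h4; omega
  have hγ₄ : ¬ IsSquare (2 * W.Δ) ∧ ¬ IsSquare (-2 * W.Δ) := by
    have hev : Even (padicValInt 2 (minimalDiscriminantInt W)) := by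
      obtain ⟨k, hk⟩ := h4; exact ⟨2 * k, by omega⟩
    exact ⟨fun h ↦ (Nat.not_odd_iff_even.mpr hev) (hodd (Or.inl h)),
      fun h ↦ (Nat.not_odd_iff_even.mpr hev) (hodd (Or.inr h))⟩
  rw [forall_hasSurjectiveModNGaloisRep_two_pow_iff_criteria]
  constructor
  · rintro ⟨hP, hΔ, hΔ₁, -, -, -⟩
    exact ⟨hP, hΔ, hΔ₁⟩
  · rintro ⟨hP, hΔ, hΔ₁⟩
    exact ⟨hP, hΔ, hΔ₁, j_ne_of_mult_two_of_emod_four_ne W hm hn4, hγ₄.1, hγ₄.2⟩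

/-- **At a multiplicative `2` with `v₂(Δ_min)` ODD: the complement is (β) ∪ (γ₄) only** — `ρ_{W,2^∞}`
is onto iff `W(ℚ)[2] = 0` and `2Δ, -2Δ ∉ ℚ^{×2}` (the conditions `Δ, -Δ ∉ ℚ^{×2}` and
`j ≠ -4t³(t + 8)` are automatic). [cite: DokchitserDokchitserMathZ2012, Theorem (1)–(3)] [cite: SilvermanAEC2009, VII.5 Prop. 5.1(b)] -/
theorem forall_hasSurjectiveModNGaloisRep_two_pow_iff_of_mult_two_of_odd (hm : Mult W 2)
    (hodd : Odd (padicValInt 2 (minimalDiscriminantInt W))) :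
    (∀ m : ℕ, W.HasSurjectiveModNGaloisRep ((2 ^ m : ℕ) : ℤ)) ↔
      (∀ P : W.toAffine.Point, 2 • P = 0 → P = 0) ∧ ¬ IsSquare (2 * W.Δ) ∧ ¬ IsSquare (-2 * W.Δ) := by
  have hΔ0 := minimalDiscriminantInt_ne_zero W
  obtain ⟨heven, -⟩ := even_or_odd_padicValInt_minimalDiscriminantInt_of_isSquare W hΔ0
  have hn4 : (padicValInt 2 (minimalDiscriminantInt W) : ℤ) % 4 ≠ 2 := by
    obtain ⟨k, hk⟩ := hodd; omega
  have hΔ : ¬ IsSquare W.Δ := fun h ↦ (Nat.not_even_iff_odd.mpr hodd) (heven (Or.inl h))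
  have hΔ₁ : ¬ IsSquare (-W.Δ) := fun h ↦ (Nat.not_even_iff_odd.mpr hodd) (heven (Or.inr h))
  rw [forall_hasSurjectiveModNGaloisRep_two_pow_iff_criteria]
  constructor
  · rintro ⟨hP, -, -, -, hΔ₂, hΔ₃⟩
    exact ⟨hP, hΔ₂, hΔ₃⟩
  · rintro ⟨hP, hΔ₂, hΔ₃⟩
    exact ⟨hP, hΔ, hΔ₁, j_ne_of_mult_two_of_emod_four_ne W hm hn4, hΔ₂, hΔ₃⟩

end MultAtTwo

end Literature.NumberTheory.EllipticCurves
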